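import Summits.ResolutionOfSingularities.ResolutionOfSingularities.Theorems.PurelyInseparableDim4LeafStep
import HarnessLib
import HarnessLib.Audit.Tags

/-!
# Purely inseparable fourfolds — the «d = 0 LEAF» step, BOOKKEEPING-FREE form (cell res-dim4-pi,
# WORD #38 (a)(2), sequel) [OURS · counted 0 · a statement about OUR frame, not about resolution]

Width seat `res-dim4-p-10` (g2).  `LeafStep.leafStep_fibre` is stated with the BOOKED exceptional vector
`r` of the presented state.  The game itself (`Edge`, `IsPermissibleCentre`, `IsEquimultiplePoint`, the
`F` of `CentreBlowup.step`) reads `F` only, and the specimens X0/X2 of `…LeafStepSpecimens` end in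
states that ARE monomial × unit as polynomials (`x₀x₁` with `r = (1,0,0,0)`; `x₁x₂(1+x₁)` with `r = 0`)
although not «d = 0» as bookkept.  Here the same theorem for ANY exponent `a` with `x^a ∣ F`,
`coeff_a F ≠ 0`, `x^a` not a `q`-th power (the intrinsic monomial part of `F`), by re-booking `r := a`:

* `leafStep_fibre_of_exponent` — cardinality-first centre, equimultiple FIBRE point ⇒ the successor's
  `F'` has the intrinsic monomial part `a' = (chart exponent of a)|_{b=0}`, `coeff_{a'} F' ≠ 0`, `x^{a'}`
  not a `q`-th power, `|a'| < |a|`, and `ord₀ F' < ord₀ F`;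
* `no_infinite_fibre_chain_of_exponent` — no infinite MODE-1h fibre chain starts at a state whose `F`
  is monomial × unit with the monomial not a `q`-th power, whatever its books `r`, `exc`.

Nothing here proves resolution of singularities in dimension ≥ 4 / characteristic `p`; counted 0; AI
work, weaker than expert review. bears_on: LADDER-RESOLUTION:D157-DOOR2 (res-dim4-pi · WORD #38 (a)(2)).
Supports stmt-ResolutionOfSingularities-16155 (helper).
-/

set_option linter.dupNamespace false

open MvPolynomial Finset

open scoped BigOperators

noncomputable section

namespace Summit.ResolutionOfSingularities.ResolutionOfSingularities.Theorems.PIDim4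

namespace LeafStep

open Literature.AlgebraicGeometry.Resolution
open Literature.AlgebraicGeometry.Resolution.Hauser2010
open CentreBlowup

section General

variable {σ : Type*} [Fintype σ] [DecidableEq σ] {K : Type*} [Field K] [DecidableEq K]

omit [Fintype σ] in
/-- The `F` of a step does not read the books `r`, `exc`. [folklore] -/
theorem step_F_rebook (q : ℕ) (S : Finset σ) (j : σ) (b : σ → K) (s : CState σ K) (a : σ →₀ ℕ)
    (E : Finset σ) : (step q S j b ⟨s.F, a, E⟩).F = (step q S j b s).F := rfl

omit [Fintype σ] [DecidableEq K] in
/-- Equimultiplicity does not read the books. [folklore] -/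
theorem isEquimultiplePoint_rebook (q : ℕ) (S : Finset σ) (j : σ) (b : σ → K) (s : CState σ K)
    (a : σ →₀ ℕ) (E : Finset σ) :
    IsEquimultiplePoint q S j b ⟨s.F, a, E⟩ ↔ IsEquimultiplePoint q S j b s := Iff.rfl

/-- **LEAF STEP IN THE FIBRE, bookkeeping-free.** Let `x^a ∣ F`, `coeff_a F ≠ 0`, `x^a` not a `q`-th
power (any exponent `a`, not necessarily the booked `r`), `S` a permissible centre of least cardinality,
`j ∈ S`, `b` an equimultiple point of the fibre over the origin.  Then with
`a' = (chartExponent q S j a)|_{b = 0}`: `x^{a'} ∣ F'`, `coeff_{a'} F' ≠ 0`, `x^{a'}` not a `q`-th power,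
`|a'| < |a|`, and `ord₀ F' < ord₀ F`, for `F' = (step q S j b s).F`. [OURS · counted 0] [folklore] -/
theorem leafStep_fibre_of_exponent {q : ℕ} (hq : 0 < q) {S : Finset σ} {j : σ} (hj : j ∈ S)
    {b : σ → K} (hbj : b j = 0) (hfib : ∀ i, i ∉ S → b i = 0) (s : CState σ K) (a : σ →₀ ℕ)
    (hdiv : ∀ d ∈ s.F.support, a ≤ d) (ha0 : coeff a s.F ≠ 0) (hcl : ¬ ∀ i, q ∣ a i)
    (hperm : (q : ℕ∞) ≤ ordAlong S s.F)
    (hleast : ∀ S' : Finset σ, S'.Nonempty → (q : ℕ∞) ≤ ordAlong S' s.F → S.card ≤ S'.card)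
    (heq : IsEquimultiplePoint q S j b s) :
    (∀ d ∈ (step q S j b s).F.support, ((chartExponent q S j a).filter fun i => b i = 0) ≤ d) ∧
      coeff ((chartExponent q S j a).filter fun i => b i = 0) (step q S j b s).F ≠ 0 ∧
      (¬ ∀ i, q ∣ ((chartExponent q S j a).filter fun i => b i = 0) i) ∧
      ((chartExponent q S j a).filter fun i => b i = 0).degree < a.degree ∧
      ordZero (step q S j b s).F < ordZero s.F := by
  -- re-book `r := a` and apply the booked theorem
  set t : CState σ K := ⟨s.F, a, s.exc⟩ with htdef
  obtain ⟨h1, h2, h3, h4⟩ := leafStep_fibre hq hj hbj hfib t hdiv ha0 hcl hperm hleast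
    ((isEquimultiplePoint_rebook q S j b s a s.exc).mpr heq)
  have hr' : (step q S j b t).r = (chartExponent q S j a).filter fun i => b i = 0 :=
    step_r_eq_filter q hbj t hdiv ha0
  have hF' : (step q S j b t).F = (step q S j b s).F := step_F_rebook q S j b s a s.exc
  rw [hr', hF'] at h1 h2
  rw [hr'] at h3 h4
  refine ⟨h1, h2, h3, h4, ?_⟩
  have ho : ordZero s.F = (a.degree : ℕ∞) := ordZero_eq_degree t hdiv ha0
  have ho' : ordZero (step q S j b s).F =
      ((((chartExponent q S j a).filter fun i => b i = 0).degree : ℕ) : ℕ∞) :=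
    ordZero_eq_degree (⟨(step q S j b s).F, (chartExponent q S j a).filter fun i => b i = 0, s.exc⟩ :
      CState σ K) h1 h2
  rw [ho, ho']
  exact_mod_cast h4

end General

/-! ## The class of record: no infinite MODE-1h fibre chain from an intrinsic leaf -/

section ClassOfRecord

variable {K : Type} [Field K] [DecidableEq K]

/-- **NO INFINITE MODE-1h FIBRE CHAIN from a state whose `F` is monomial × unit** (the monomial not a
`q`-th power), whatever the books `r`, `exc` say along the chain. [OURS · counted 0] [folklore] -/
theorem no_infinite_fibre_chain_of_exponent {q : ℕ} (hq : 0 < q) (c : ℕ → State K)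
    (S : ℕ → Finset (Fin 4)) (j : ℕ → Fin 4) (b : ℕ → Fin 4 → K) (a : Fin 4 →₀ ℕ)
    (hleaf : (∀ d ∈ (c 0).F.support, a ≤ d) ∧ coeff a (c 0).F ≠ 0 ∧ ¬ ∀ i, q ∣ a i)
    (hstep : ∀ k, IsMode1hCentre q (S k) (c k).F ∧ j k ∈ S k ∧ b k (j k) = 0 ∧
      (∀ i, i ∉ S k → b k i = 0) ∧ CentreBlowup.IsEquimultiplePoint q (S k) (j k) (b k) (c k) ∧
      c (k + 1) = CentreBlowup.step q (S k) (j k) (b k) (c k)) : False := by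
  -- carry an intrinsic exponent along the chain; its degree drops every step
  have hall : ∀ k, ∃ e : Fin 4 →₀ ℕ, ((∀ d ∈ (c k).F.support, e ≤ d) ∧ coeff e (c k).F ≠ 0 ∧
      ¬ ∀ i, q ∣ e i) ∧ e.degree + k ≤ a.degree := by
    intro k
    induction k with
    | zero => exact ⟨a, hleaf, by simp⟩
    | succ k ih =>
      obtain ⟨e, ⟨h1, h2, h3⟩, hdeg⟩ := ih
      obtain ⟨h1h, hj, hbj, hfib, heq, hc⟩ := hstep k
      obtain ⟨a1, a2, a3, a4, -⟩ := leafStep_fibre_of_exponent hq hj hbj hfib (c k) e h1 h2 h3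
        h1h.1.2 (fun S' hS' hq' => h1h.2 S' ⟨hS', hq'⟩) heq
      refine ⟨(CentreBlowup.chartExponent q (S k) (j k) e).filter fun i => b k i = 0, ?_, ?_⟩
      · rw [hc]; exact ⟨a1, a2, a3⟩
      · omega
  obtain ⟨e, -, hdeg⟩ := hall (a.degree + 1)
  omega

end ClassOfRecord

end LeafStep

end Summit.ResolutionOfSingularities.ResolutionOfSingularities.Theorems.PIDim4

end
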